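import Mathlib
import Literature.Algebra.Homology.ExtModPowers

/-!
# Venture HSemireg — THEOREM P's necessity step in the kernel: obstruction classes natural along a short exact
# sequence FACTOR THROUGH THE PRESENTATION when the obstruction of the presented object vanishes (both levels)

HONEST FRAMING. Lean side of the computation cell `pub-hsemireg` (S4-PUSH, H2 door PAD-4; seat s4-prove-1 g25,
2026-08-28; TIER-3 = first kernel piece of the MODEL-TO-SHEAF BRIDGE of `Pad4FirstOrderModel.lean` (row 716) and
`Pad4FirstOrderModelEnd.lean` (`theoremLZeta_holds`)). GENERIC HOMOLOGICAL ALGEBRA in an arbitrary abelian category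
with Mathlib's derived `CategoryTheory.Abelian.Ext`; every proof is a long-exact-sequence step
(`Ext.covariant_sequence_exact₂`, `Ext.contravariant_sequence_exact₁`), biproduct bookkeeping
(`Ext.comp_sum`, `biproduct.ι_π`) or `ℤ`-bilinearity of `Ext.comp` (the tree's `Literature.Algebra.Homology.Ext.zsmul_comp`
∕ `Ext.comp_zsmul`, the only reason for the one Literature import). Nothing here constructs a variety, a sheaf, an Atiyah class or a semiregularity
map; no Literature FACT (`def … : Prop`) is declared or used; no instance, no notation; no object is certified; census-neutral.
NOTHING HERE SAYS THAT HC ∕ HC_CM ∕ HC_AV ∕ W₆ ∕ HC_Kum4Type HOLDS OR FAILS, and nothing here is a statement about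
`stub_rung_pad4_seedAt`.

WHAT THIS FILE IS (the dictionary to row 716, §3 of `Pad4FirstOrderModel.lean`). A two-level design is a short exact
sequence `0 → E₊ →φ E₋ →g E → 0` (there: `E₊ = ⊕_j P_j`, `E₋ = ⊕_i N_i`, line bundles on `S⁴`). A first-order
obstruction theory along one tangent direction `κ` assigns to each of `E₊, E₋, E` a degree-`n` self-extension
(`n = 2` there: `ob_κ(X) = κ ∪ At(X) ∈ Ext²(X, X)`), NATURAL with respect to `φ`, to `g` and to the extension class
`[S] ∈ Ext¹(E, E₊)` (the three commuting squares `NaturalAlong.comm_f ∕ comm_g ∕ comm_δ` below; for Atiyah-type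
obstructions they hold because the Atiyah class is functorial on the derived category — THAT functoriality, the
Künneth–Leray coordinates of row 716 §THE MODEL and the formula `ob_κ = κ ∪ c₁` on line bundles are NOT in this file
and remain the paper part of the bridge). THEOREM P's necessity step (cell documents DOORY0-SCOPING §2 LEMMA and
vhodge ROUTE-P3 THEOREM P «… or of E₊», quoted in row 716's docstring of `Design.H2` as «necessary for `ob_κ(E) = 0`»)
is then the pair of long-exact-sequence facts proved here:
* LOWER LEVEL (`exists_lower_of_natural`): `ob(E) = 0 ⇒ ∃ η ∈ Extⁿ(E₋, E₊), η ∘ φ = ob(E₋)` — uses `comm_g` only;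
* UPPER LEVEL (`exists_upper_of_natural`, «or of E₊»): `ob(E) = 0 ⇒ ∃ η′ ∈ Extⁿ(E₋, E₊), φ ∘ η′ = ob(E₊)` — uses
  `comm_δ` only;
and, when `E₊ = ⨁ P`, `E₋ = ⨁ N` are finite biproducts and the theory is also natural with respect to the biproduct
injections ∕ projections (so that `ob(⨁ N)` is block-diagonal, `blockDiagonal_of_natural_ι`), the two factorisations
READ ENTRYWISE are exactly the shapes of row 716's `Design.LowerColumnSolvable` (column `N_i`: `Σ_j φ_{N_r P_j} ∘ η_j =
δ_{ri} ob(N_i)` for all `r`) and `Design.UpperRowSolvable` (row object `P_j`: `Σ_i η′_i ∘ φ_{N_i P_s} = δ_{sj} ob(P_j)`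
for all `s`; row 716 keeps only the `UpperRowPure` rows — a necessary condition may drop rows):
`lowerColumns_of_lower`, `upperRows_of_upper`. Finally (§4) the three squares themselves are reduced to primitive
ones: for an obstruction of the form `ob(X) = a(X) ≫ c(X)` (`a` Atiyah-like `X → T X`, `c` contraction-like `T X → X`)
naturality of `a` and of `c` along `φ`, `g` and the connecting classes of `S` and of the twisted sequence gives a
`NaturalAlong` datum (`NaturalAlong.ofComposite`; the tree's `atiyahClass_naturality` is the `a`-square along module
maps; the other primitive squares are NOT in the tree). Composition convention: Mathlib's `Ext.comp` is diagrammatic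
(`α.comp β` = «`α` then `β`»).

SOURCES (cell documents, sha16; dictionary only): Pad4FirstOrderModel.lean (row 716, §3 docstrings of `LowerColumnSolvable`,
`UpperRowSolvable`, `H2`); DOORY0-SCOPING-search-1.md 6646c0578f77052d §2 LEMMA; PAD4-FIRSTORDER-search-1.md v1.1
93f71c42cb445756 §0 (H2) («THEOREM P (a)(b) applied on BOTH sides (g : E₋ → E and δ : E → E₊[1])»);
PAD4-DIAGCLOSURE-search-1.md v1.2 7d6949f2a7067e18 §6 (E1).
-/

noncomputable section
namespace Summit.Ventures.HSemireg.TwoLevelObstruction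

open CategoryTheory CategoryTheory.Abelian CategoryTheory.Limits

universe w v u

variable {C : Type u} [Category.{v} C] [Abelian C] [HasExt.{w} C]

/-! ## §1 One short exact sequence: the two long-exact-sequence steps -/

section OneSequence

variable {S : ShortComplex C} {n : ℕ}

/-- LOWER LEVEL, raw form: a class `ω₋ ∈ Extⁿ(E₋, E₋)` killed by the quotient map `g : E₋ → E` factors through
`φ : E₊ → E₋`: `∃ η ∈ Extⁿ(E₋, E₊), η ∘ φ = ω₋` (exactness of `Extⁿ(E₋, E₊) → Extⁿ(E₋, E₋) → Extⁿ(E₋, E)`). -/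
theorem exists_lower_of_comp_g_eq_zero (hS : S.ShortExact) (ω₂ : Ext S.X₂ S.X₂ n)
    (h : ω₂.comp (Ext.mk₀ S.g) (add_zero n) = 0) :
    ∃ η : Ext S.X₂ S.X₁ n, η.comp (Ext.mk₀ S.f) (add_zero n) = ω₂ :=
  Ext.covariant_sequence_exact₂ (hS := hS) (X := S.X₂) ω₂ h

/-- UPPER LEVEL, raw form («or of `E₊`»): a class `ω₊ ∈ Extⁿ(E₊, E₊)` killed by the extension class
`[S] ∈ Ext¹(E, E₊)` (`[S] ∘ ω₊ = 0` in `Extⁿ⁺¹(E, E₊)`) lifts along `φ^*`: `∃ η′ ∈ Extⁿ(E₋, E₊), φ ∘ η′ = ω₊`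
(exactness of `Extⁿ(E₋, E₊) → Extⁿ(E₊, E₊) → Extⁿ⁺¹(E, E₊)`). -/
theorem exists_upper_of_extClass_comp_eq_zero (hS : S.ShortExact) (ω₁ : Ext S.X₁ S.X₁ n)
    (h : hS.extClass.comp ω₁ (add_comm 1 n) = 0) :
    ∃ η' : Ext S.X₂ S.X₁ n, (Ext.mk₀ S.f).comp η' (zero_add n) = ω₁ :=
  Ext.contravariant_sequence_exact₁ (hS := hS) (Y := S.X₁) ω₁ (add_comm 1 n) h

/-- A degree-`n` **obstruction datum natural along** the short exact sequence `S : 0 → E₊ →φ E₋ →g E → 0`: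
self-extensions `ω₊, ω₋, ω` of the three objects commuting with `φ`, with `g`, and with the extension class `[S]`
(the last square up to the sign `ε`, left free: sign conventions for the connecting class differ between sources and
play no role). For `ob_κ = κ ∪ At(·)` these squares are the functoriality of the Atiyah class on the derived category
(NOT proved here; §4 reduces them to primitive squares). The square `comm_f` is CARRIED BUT UNUSED by the necessity
theorems below (`exists_lower` reads `comm_g`, `exists_upper` reads `comm_δ`); it is kept because it is part of the
notion «natural along `S`» and is supplied anyway by `NaturalAlong.ofComposite`. [definition of this file] -/
structure NaturalAlong (hS : S.ShortExact) (n : ℕ) where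
  /-- the obstruction of `E₊ = S.X₁`. -/
  ω₁ : Ext S.X₁ S.X₁ n
  /-- the obstruction of `E₋ = S.X₂`. -/
  ω₂ : Ext S.X₂ S.X₂ n
  /-- the obstruction of `E = S.X₃`. -/
  ω₃ : Ext S.X₃ S.X₃ n
  /-- the sign in the square with the connecting class. -/
  ε : ℤˣ
  /-- naturality w.r.t. `φ = S.f`: `φ` then `ω₋` equals `ω₊` then `φ` in `Extⁿ(E₊, E₋)`. -/
  comm_f : (Ext.mk₀ S.f).comp ω₂ (zero_add n) = ω₁.comp (Ext.mk₀ S.f) (add_zero n)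
  /-- naturality w.r.t. `g = S.g`: `g` then `ω` equals `ω₋` then `g` in `Extⁿ(E₋, E)`. -/
  comm_g : (Ext.mk₀ S.g).comp ω₃ (zero_add n) = ω₂.comp (Ext.mk₀ S.g) (add_zero n)
  /-- naturality w.r.t. the extension class `[S] ∈ Ext¹(E, E₊)`: `[S]` then `ω₊` equals `± ω` then `[S]`. -/
  comm_δ : hS.extClass.comp ω₁ (add_comm 1 n) = (ε : ℤ) • ω₃.comp hS.extClass rfl

variable {hS : S.ShortExact}

/-- **THEOREM P, lower level (necessity of (E1) on `E₋`).** If the obstruction of the presented object `E`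
vanishes, the obstruction of `E₋` factors through the presentation: `∃ η ∈ Extⁿ(E₋, E₊)` with `η ∘ φ = ω₋`.
Uses `comm_g` only. -/
theorem NaturalAlong.exists_lower (O : NaturalAlong hS n) (h : O.ω₃ = 0) :
    ∃ η : Ext S.X₂ S.X₁ n, η.comp (Ext.mk₀ S.f) (add_zero n) = O.ω₂ :=
  exists_lower_of_comp_g_eq_zero hS O.ω₂ (by rw [← O.comm_g, h, Ext.comp_zero])

/-- **THEOREM P, upper level («or of `E₊`»; necessity of (E1) on `E₊`).** If the obstruction of `E` vanishes, the
obstruction of `E₊` lifts along `φ^*`: `∃ η′ ∈ Extⁿ(E₋, E₊)` with `φ ∘ η′ = ω₊`. Uses `comm_δ` only. -/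
theorem NaturalAlong.exists_upper (O : NaturalAlong hS n) (h : O.ω₃ = 0) :
    ∃ η' : Ext S.X₂ S.X₁ n, (Ext.mk₀ S.f).comp η' (zero_add n) = O.ω₁ :=
  exists_upper_of_extClass_comp_eq_zero hS O.ω₁ (by rw [O.comm_δ, h, Ext.zero_comp, smul_zero])

/-- **THEOREM P, both levels at once** (the shape of row 716's `Design.H2`: lower AND upper systems solvable). -/
theorem NaturalAlong.exists_lower_and_upper (O : NaturalAlong hS n) (h : O.ω₃ = 0) :
    (∃ η : Ext S.X₂ S.X₁ n, η.comp (Ext.mk₀ S.f) (add_zero n) = O.ω₂) ∧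
      ∃ η' : Ext S.X₂ S.X₁ n, (Ext.mk₀ S.f).comp η' (zero_add n) = O.ω₁ :=
  ⟨O.exists_lower h, O.exists_upper h⟩

/-- Conversely the two factorisations say exactly that `ω₋` dies under `g_*` and `ω₊` dies under `[S] ∘ −`
(the parts of `ω = 0` seen by `E₋` and by `E₊`); they do NOT give `ω = 0` back — (E1) is necessary, not
sufficient (row 716 docstring). Lower half of that remark: -/
theorem comp_g_eq_zero_of_lower {ω₂ : Ext S.X₂ S.X₂ n} {η : Ext S.X₂ S.X₁ n}
    (h : η.comp (Ext.mk₀ S.f) (add_zero n) = ω₂) : ω₂.comp (Ext.mk₀ S.g) (add_zero n) = 0 := by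
  rw [← h, Ext.comp_assoc_of_third_deg_zero, Ext.mk₀_comp_mk₀, S.zero, Ext.mk₀_zero, Ext.comp_zero]

/-- Upper half of the same remark: a class lifted along `φ^*` is killed by `[S] ∘ −`. -/
theorem extClass_comp_eq_zero_of_upper (hS : S.ShortExact) {ω₁ : Ext S.X₁ S.X₁ n} {η' : Ext S.X₂ S.X₁ n}
    (h : (Ext.mk₀ S.f).comp η' (zero_add n) = ω₁) : hS.extClass.comp ω₁ (add_comm 1 n) = 0 := by
  rw [← h]
  exact hS.extClass_comp_assoc η'

end OneSequence

/-! ## §2 Finite biproducts: the factorisations read entrywise (row 716's columns and rows)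

`E₋ = ⨁ N` (`N : I → C`), `E₊ = ⨁ P` (`P : J → C`), `φ : ⨁ P ⟶ ⨁ N` with entries `φ_{ij} : P j ⟶ N i`; a class
`η ∈ Extⁿ(⨁ N, ⨁ P)` has entries `η_{ij} ∈ Extⁿ(N i, P j)` and a self-class of `⨁ N` (resp. `⨁ P`) has entries in
`Extⁿ(N i, N r)` (resp. `Extⁿ(P s, P j)`). No short exactness is needed in this section: it is bookkeeping with
`biproduct.total` and the bilinearity of `Ext.comp`. Finite biproducts are taken as a hypothesis `[HasFiniteBiproducts C]`
(every abelian category has them: Mathlib's `Abelian.hasFiniteBiproducts`, a theorem rather than an instance). -/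

section Biproducts

variable [HasFiniteBiproducts C]
variable {I J : Type} [Fintype I] [Fintype J]
variable {N : I → C} {P : J → C} {n : ℕ}

/-- the entry `φ_{ij} : P j ⟶ N i` of `φ : ⨁ P ⟶ ⨁ N` (row 716: the section `φ_{N_i P_j} ∈ H⁰(N_i − P_j)`). -/
def entry (φ : ⨁ P ⟶ ⨁ N) (i : I) (j : J) : P j ⟶ N i :=
  biproduct.ι P j ≫ φ ≫ biproduct.π N i

/-- the entry `η_{ij} ∈ Extⁿ(N i, P j)` of a class `η ∈ Extⁿ(⨁ N, ⨁ P)` (row 716: the unknowns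
`η_j ∈ H²(P_j − N_i)` of column `N_i`, resp. `η′_i ∈ H²(P_j − N_i)` of the row object `P_j`). -/
def extEntry (η : Ext (⨁ N) (⨁ P) n) (i : I) (j : J) : Ext (N i) (P j) n :=
  ((Ext.mk₀ (biproduct.ι N i)).comp η (zero_add n)).comp (Ext.mk₀ (biproduct.π P j)) (add_zero n)

/-- the entry in `Extⁿ(N i, N r)` of a self-class of `E₋ = ⨁ N`. -/
def lowerSelfEntry (ω : Ext (⨁ N) (⨁ N) n) (i r : I) : Ext (N i) (N r) n :=
  ((Ext.mk₀ (biproduct.ι N i)).comp ω (zero_add n)).comp (Ext.mk₀ (biproduct.π N r)) (add_zero n)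

/-- the entry in `Extⁿ(P s, P j)` of a self-class of `E₊ = ⨁ P`. -/
def upperSelfEntry (ω : Ext (⨁ P) (⨁ P) n) (s j : J) : Ext (P s) (P j) n :=
  ((Ext.mk₀ (biproduct.ι P s)).comp ω (zero_add n)).comp (Ext.mk₀ (biproduct.π P j)) (add_zero n)

omit [HasExt C] in
/-- `φ` followed by the projection to `N r`, as a sum over the entries of `φ`. -/
theorem comp_π_eq_sum_entry (φ : ⨁ P ⟶ ⨁ N) (r : I) :
    φ ≫ biproduct.π N r = ∑ j, biproduct.π P j ≫ entry φ r j := by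
  simp only [entry, ← Category.assoc]
  rw [← Preadditive.sum_comp, ← Preadditive.sum_comp, biproduct.total, Category.id_comp]

omit [HasExt C] in
/-- the injection of `P s` followed by `φ`, as a sum over the entries of `φ`. -/
theorem ι_comp_eq_sum_entry (φ : ⨁ P ⟶ ⨁ N) (s : J) :
    biproduct.ι P s ≫ φ = ∑ i, entry φ i s ≫ biproduct.ι N i := by
  simp only [entry, Category.assoc]
  rw [← Preadditive.comp_sum, ← Preadditive.comp_sum, biproduct.total, Category.comp_id]

/-- **LOWER factorisation read entrywise** (row 716 `Design.lowerLHS`): if `η ∘ φ = ω₋` in `Extⁿ(⨁ N, ⨁ N)` then for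
every column `i` and every row `r`, `Σ_j η_{ij} ∘ φ_{rj} = (ω₋)_{ir}` in `Extⁿ(N i, N r)`. -/
theorem lowerColumns_of_lower {φ : ⨁ P ⟶ ⨁ N} {η : Ext (⨁ N) (⨁ P) n} {ω : Ext (⨁ N) (⨁ N) n}
    (h : η.comp (Ext.mk₀ φ) (add_zero n) = ω) (i r : I) :
    ∑ j, (extEntry η i j).comp (Ext.mk₀ (entry φ r j)) (add_zero n) = lowerSelfEntry ω i r := by
  subst h
  simp only [extEntry, lowerSelfEntry, Ext.comp_assoc_of_third_deg_zero, Ext.mk₀_comp_mk₀, ← Ext.comp_sum,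
    ← Ext.mk₀_sum, comp_π_eq_sum_entry]

/-- **UPPER factorisation read entrywise** (row 716 `Design.upperLHS`): if `φ ∘ η′ = ω₊` in `Extⁿ(⨁ P, ⨁ P)` then for
every row object `j` and every `s`, `Σ_i φ_{is} ∘ η′_{ij} = (ω₊)_{sj}` in `Extⁿ(P s, P j)`. -/
theorem upperRows_of_upper {φ : ⨁ P ⟶ ⨁ N} {η' : Ext (⨁ N) (⨁ P) n} {ω : Ext (⨁ P) (⨁ P) n}
    (h : (Ext.mk₀ φ).comp η' (zero_add n) = ω) (s j : J) :
    ∑ i, (Ext.mk₀ (entry φ i s)).comp (extEntry η' i j) (zero_add n) = upperSelfEntry ω s j := by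
  subst h
  simp only [extEntry, upperSelfEntry, Ext.comp_assoc_of_third_deg_zero, Ext.mk₀_comp_mk₀_assoc,
    ι_comp_eq_sum_entry, Ext.mk₀_sum, Ext.sum_comp]

/-- **Block-diagonality of a natural obstruction on `⨁ N`, diagonal entry**: if `ω` commutes with the injection of
`N i` (`ι_i` then `ω` = `ω_i` then `ι_i`), its `(i,i)` entry is `ω_i`. -/
theorem lowerSelfEntry_self_of_natural {ω : Ext (⨁ N) (⨁ N) n} {i : I} {ωi : Ext (N i) (N i) n}
    (hnat : (Ext.mk₀ (biproduct.ι N i)).comp ω (zero_add n) = ωi.comp (Ext.mk₀ (biproduct.ι N i)) (add_zero n)) :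
    lowerSelfEntry ω i i = ωi := by
  simp only [lowerSelfEntry, hnat, Ext.comp_assoc_of_third_deg_zero, Ext.mk₀_comp_mk₀, biproduct.ι_π_self,
    Ext.comp_mk₀_id]

/-- **Block-diagonality, off-diagonal entry**: under the same naturality the `(i,r)` entry vanishes for `r ≠ i`. -/
theorem lowerSelfEntry_ne_of_natural {ω : Ext (⨁ N) (⨁ N) n} {i r : I} {ωi : Ext (N i) (N i) n}
    (hnat : (Ext.mk₀ (biproduct.ι N i)).comp ω (zero_add n) = ωi.comp (Ext.mk₀ (biproduct.ι N i)) (add_zero n))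
    (hir : i ≠ r) : lowerSelfEntry ω i r = 0 := by
  simp only [lowerSelfEntry, hnat, Ext.comp_assoc_of_third_deg_zero, Ext.mk₀_comp_mk₀, biproduct.ι_π_ne _ hir,
    Ext.mk₀_zero, Ext.comp_zero]

/-- The same for `⨁ P`, diagonal entry. -/
theorem upperSelfEntry_self_of_natural {ω : Ext (⨁ P) (⨁ P) n} {s : J} {ωs : Ext (P s) (P s) n}
    (hnat : (Ext.mk₀ (biproduct.ι P s)).comp ω (zero_add n) = ωs.comp (Ext.mk₀ (biproduct.ι P s)) (add_zero n)) :
    upperSelfEntry ω s s = ωs := by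
  simp only [upperSelfEntry, hnat, Ext.comp_assoc_of_third_deg_zero, Ext.mk₀_comp_mk₀, biproduct.ι_π_self,
    Ext.comp_mk₀_id]

/-- The same for `⨁ P`, off-diagonal entry. -/
theorem upperSelfEntry_ne_of_natural {ω : Ext (⨁ P) (⨁ P) n} {s j : J} {ωs : Ext (P s) (P s) n}
    (hnat : (Ext.mk₀ (biproduct.ι P s)).comp ω (zero_add n) = ωs.comp (Ext.mk₀ (biproduct.ι P s)) (add_zero n))
    (hsj : s ≠ j) : upperSelfEntry ω s j = 0 := by
  simp only [upperSelfEntry, hnat, Ext.comp_assoc_of_third_deg_zero, Ext.mk₀_comp_mk₀, biproduct.ι_π_ne _ hsj,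
    Ext.mk₀_zero, Ext.comp_zero]

end Biproducts

/-! ## §3 THEOREM P for a two-level design `0 → ⨁ P →φ ⨁ N → E → 0` with a constituentwise-natural obstruction

The exact shapes of row 716: `Design.LowerColumnSolvable φ κ i` = «`∃ η, ∀ r, Σ_j φ_{N_r P_j} ∘ η_j = δ_{ri} ob_κ(N_i)`»
and `Design.UpperRowSolvable φ κ j` = «`∃ η′, ∀ s` (kept rows), `Σ_i η′_i ∘ φ_{N_i P_s} = δ_{sj} ob_κ(P_j)`», with
the Kronecker deltas split into the cases `r = i` ∕ `r ≠ i`. -/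

section TwoLevel

variable [HasFiniteBiproducts C]
variable {I J : Type} [Fintype I] [Fintype J]
variable {N : I → C} {P : J → C} {E : C} {n : ℕ}
variable {φ : ⨁ P ⟶ ⨁ N} {g : ⨁ N ⟶ E} {w : φ ≫ g = 0}

/-- A degree-`n` obstruction datum on a TWO-LEVEL DESIGN `0 → ⨁ P →φ ⨁ N →g E → 0` (short exact): a datum natural
along the sequence (`NaturalAlong`) together with the obstructions `ωN i`, `ωP j` of the constituents, natural w.r.t.
the biproduct injections (for `ob_κ = κ ∪ At` once more the functoriality of the Atiyah class, NOT proved here).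
[definition of this file] -/
structure OnDesign (hS : (ShortComplex.mk φ g w).ShortExact) (n : ℕ) extends NaturalAlong hS n where
  /-- the obstruction of the lower constituent `N i`. -/
  ωN : ∀ i, Ext (N i) (N i) n
  /-- the obstruction of the upper constituent `P j`. -/
  ωP : ∀ j, Ext (P j) (P j) n
  /-- naturality w.r.t. the injection `N i → E₋ = ⨁ N`. -/
  comm_ιN : ∀ i, (Ext.mk₀ (biproduct.ι N i)).comp ω₂ (zero_add n) = (ωN i).comp (Ext.mk₀ (biproduct.ι N i)) (add_zero n)
  /-- naturality w.r.t. the injection `P j → E₊ = ⨁ P`. -/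
  comm_ιP : ∀ j, (Ext.mk₀ (biproduct.ι P j)).comp ω₁ (zero_add n) = (ωP j).comp (Ext.mk₀ (biproduct.ι P j)) (add_zero n)

variable {hS : (ShortComplex.mk φ g w).ShortExact}

/-- **THEOREM P on a two-level design, LOWER level = row 716's `LowerColumnSolvable` for every column** (the demand row
`r = i` AND every off-diagonal row `r ≠ i`): if `ob(E) = 0` then for every `i` there are `η_j ∈ Extⁿ(N i, P j)` with
`Σ_j η_j ∘ φ_{ij} = ob(N i)` and `Σ_j η_j ∘ φ_{rj} = 0` for `r ≠ i`. -/
theorem OnDesign.lowerColumnSolvable (O : OnDesign hS n) (h : O.ω₃ = 0) (i : I) :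
    ∃ η : ∀ j, Ext (N i) (P j) n,
      (∑ j, (η j).comp (Ext.mk₀ (entry φ i j)) (add_zero n) = O.ωN i) ∧
        ∀ r, i ≠ r → ∑ j, (η j).comp (Ext.mk₀ (entry φ r j)) (add_zero n) = 0 := by
  obtain ⟨η, hη⟩ := O.exists_lower h
  exact ⟨fun j => extEntry η i j,
    (lowerColumns_of_lower hη i i).trans (lowerSelfEntry_self_of_natural (O.comm_ιN i)),
    fun r hir => (lowerColumns_of_lower hη i r).trans (lowerSelfEntry_ne_of_natural (O.comm_ιN i) hir)⟩

/-- **THEOREM P on a two-level design, UPPER level («or of `E₊`») = row 716's `UpperRowSolvable` for every row object,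
ALL rows**: if `ob(E) = 0` then for every `j` there are `η′_i ∈ Extⁿ(N i, P j)` with `Σ_i φ_{ij} ∘ η′_i = ob(P j)`
and `Σ_i φ_{is} ∘ η′_i = 0` for `s ≠ j`. This abstract «all rows» necessity is the STRONGER statement; row 716's
`UpperRowPure` filter (only rows all of whose geometric participants have model coordinates are imposed) is the
coordinate-side weakening of it, so a solution here restricts to a solution there. -/
theorem OnDesign.upperRowSolvable (O : OnDesign hS n) (h : O.ω₃ = 0) (j : J) :
    ∃ η' : ∀ i, Ext (N i) (P j) n,
      (∑ i, (Ext.mk₀ (entry φ i j)).comp (η' i) (zero_add n) = O.ωP j) ∧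
        ∀ s, s ≠ j → ∑ i, (Ext.mk₀ (entry φ i s)).comp (η' i) (zero_add n) = 0 := by
  obtain ⟨η', hη'⟩ := O.exists_upper h
  exact ⟨fun i => extEntry η' i j,
    (upperRows_of_upper hη' j j).trans (upperSelfEntry_self_of_natural (O.comm_ιP j)),
    fun s hsj => (upperRows_of_upper hη' s j).trans (upperSelfEntry_ne_of_natural (O.comm_ιP s) hsj)⟩

/-- **THEOREM P, both levels — the shape of row 716's `Design.H2` at one direction `κ`** («for every column the lower
system and for every row object the upper system are solvable»), from the single hypothesis `ob(E) = 0`. -/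
theorem OnDesign.lower_and_upper (O : OnDesign hS n) (h : O.ω₃ = 0) :
    (∀ i, ∃ η : ∀ j, Ext (N i) (P j) n,
      (∑ j, (η j).comp (Ext.mk₀ (entry φ i j)) (add_zero n) = O.ωN i) ∧
        ∀ r, i ≠ r → ∑ j, (η j).comp (Ext.mk₀ (entry φ r j)) (add_zero n) = 0) ∧
    ∀ j, ∃ η' : ∀ i, Ext (N i) (P j) n,
      (∑ i, (Ext.mk₀ (entry φ i j)).comp (η' i) (zero_add n) = O.ωP j) ∧
        ∀ s, s ≠ j → ∑ i, (Ext.mk₀ (entry φ i s)).comp (η' i) (zero_add n) = 0 :=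
  ⟨fun i => O.lowerColumnSolvable h i, fun j => O.upperRowSolvable h j⟩

end TwoLevel

/-! ## §4 Obstructions of the form `ob = a ≫ c`: the three squares from the naturality of the factors

For `ob_κ(X) = κ ∪ At(X)` one has `ob(X) = a(X) ≫ c(X)` with `a(X) ∈ Extᵖ(X, T X)` (Atiyah-like, `p = 1`,
`T = (·) ⊗ Ω¹`; its naturality along MODULE maps is the tree's `atiyahClass_naturality` ∕ `atiyahClass'_naturality`)
and `c(X) ∈ Ext^q(T X, X)` (contraction with `κ`, `q = 1`). The squares `comm_f ∕ comm_g` of `NaturalAlong` then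
follow from the naturality of `a` and `c` along `φ` and `g` (`comp_natural₀`), and `comm_δ` from their naturality along
the extension classes of `S` and of `T S` (`comp_natural_δ`; signs multiply). Pure `Ext` algebra; `T`, `a`, `c` are
NOT constructed here. -/

section Composite

variable {X Y TX TY : C} {p q n : ℕ} {S : ShortComplex C}

/-- **Naturality of a composite along a morphism.** If `a` commutes with `f` (through `Tf` on the twisted side) and
`c` commutes back, then `ob = a ≫ c` commutes with `f`: the shape of `NaturalAlong.comm_f ∕ comm_g` and of
`OnDesign.comm_ιN ∕ comm_ιP`. -/
theorem comp_natural₀ (f : X ⟶ Y) (Tf : TX ⟶ TY) (aX : Ext X TX p) (aY : Ext Y TY p) (cX : Ext TX X q)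
    (cY : Ext TY Y q) (h : p + q = n)
    (ha : aX.comp (Ext.mk₀ Tf) (add_zero p) = (Ext.mk₀ f).comp aY (zero_add p))
    (hc : cX.comp (Ext.mk₀ f) (add_zero q) = (Ext.mk₀ Tf).comp cY (zero_add q)) :
    (Ext.mk₀ f).comp (aY.comp cY h) (zero_add n) = (aX.comp cX h).comp (Ext.mk₀ f) (add_zero n) := by
  rw [← Ext.comp_assoc (Ext.mk₀ f) aY cY (zero_add p) h (by omega), ← ha, Ext.comp_assoc_of_second_deg_zero,
    ← hc, ← Ext.comp_assoc_of_third_deg_zero]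

/-- **Naturality of a composite along degree-one classes** (the extension classes `δ ∈ Ext¹(X, Y)` of `S` and
`Tδ ∈ Ext¹(TX, TY)` of the twisted sequence): if `δ ≫ a(Y) = εa • a(X) ≫ Tδ` and `Tδ ≫ c(Y) = εc • c(X) ≫ δ` then
`δ ≫ ob(Y) = (εa εc) • ob(X) ≫ δ` — the shape of `NaturalAlong.comm_δ` (there `X = E`, `Y = E₊`). -/
theorem comp_natural_δ (δ : Ext X Y 1) (Tδ : Ext TX TY 1) (aX : Ext X TX p) (aY : Ext Y TY p) (cX : Ext TX X q)
    (cY : Ext TY Y q) (h : p + q = n) (εa εc : ℤ)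
    (ha : δ.comp aY (add_comm 1 p) = εa • aX.comp Tδ rfl)
    (hc : Tδ.comp cY (add_comm 1 q) = εc • cX.comp δ rfl) :
    δ.comp (aY.comp cY h) (add_comm 1 n) = (εa * εc) • (aX.comp cX h).comp δ rfl := by
  rw [← Ext.comp_assoc δ aY cY (add_comm 1 p) h (by omega), ha, Literature.Algebra.Homology.Ext.zsmul_comp,
    Ext.comp_assoc aX Tδ cY rfl (add_comm 1 q) (by omega), hc, Literature.Algebra.Homology.Ext.comp_zsmul,
    smul_smul, ← Ext.comp_assoc aX cX δ h rfl (by omega)]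

/-- **The three squares of `NaturalAlong` from six primitive ones.** For a composite obstruction
`ob(X) = a(X) ≫ c(X)` on the three objects of `S`, with twisted objects `T₁, T₂, T₃`, twisted maps `Tf, Tg` and a
twisted connecting class `Tδ ∈ Ext¹(T₃, T₁)`: naturality of `a` and of `c` along `φ`, along `g` and along the
connecting classes gives a datum natural along `S` (so `exists_lower ∕ exists_upper` apply). For `ob_κ = κ ∪ At`
the inputs are the functoriality of the Atiyah class (`a`) and of the contraction with `κ` (`c`) — NOT proved here. -/
def NaturalAlong.ofComposite (hS : S.ShortExact) {T₁ T₂ T₃ : C} {p q n : ℕ} (h : p + q = n)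
    (Tf : T₁ ⟶ T₂) (Tg : T₂ ⟶ T₃) (Tδ : Ext T₃ T₁ 1)
    (a₁ : Ext S.X₁ T₁ p) (a₂ : Ext S.X₂ T₂ p) (a₃ : Ext S.X₃ T₃ p)
    (c₁ : Ext T₁ S.X₁ q) (c₂ : Ext T₂ S.X₂ q) (c₃ : Ext T₃ S.X₃ q) (εa εc : ℤˣ)
    (ha_f : a₁.comp (Ext.mk₀ Tf) (add_zero p) = (Ext.mk₀ S.f).comp a₂ (zero_add p))
    (hc_f : c₁.comp (Ext.mk₀ S.f) (add_zero q) = (Ext.mk₀ Tf).comp c₂ (zero_add q))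
    (ha_g : a₂.comp (Ext.mk₀ Tg) (add_zero p) = (Ext.mk₀ S.g).comp a₃ (zero_add p))
    (hc_g : c₂.comp (Ext.mk₀ S.g) (add_zero q) = (Ext.mk₀ Tg).comp c₃ (zero_add q))
    (ha_δ : hS.extClass.comp a₁ (add_comm 1 p) = (εa : ℤ) • a₃.comp Tδ rfl)
    (hc_δ : Tδ.comp c₁ (add_comm 1 q) = (εc : ℤ) • c₃.comp hS.extClass rfl) : NaturalAlong hS n where
  ω₁ := a₁.comp c₁ h
  ω₂ := a₂.comp c₂ h
  ω₃ := a₃.comp c₃ h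
  ε := εa * εc
  comm_f := comp_natural₀ S.f Tf a₁ a₂ c₁ c₂ h ha_f hc_f
  comm_g := comp_natural₀ S.g Tg a₂ a₃ c₂ c₃ h ha_g hc_g
  comm_δ := by
    rw [Units.val_mul]
    exact comp_natural_δ hS.extClass Tδ a₃ a₁ c₃ c₁ h εa εc ha_δ hc_δ

/-- … and its obstruction of `E` is the composite `a(E) ≫ c(E)` (so `exists_lower ∕ exists_upper` read:
`a(E) ≫ c(E) = 0 ⇒` the two factorisations). -/
theorem NaturalAlong.ofComposite_ω₃ (hS : S.ShortExact) {T₁ T₂ T₃ : C} {p q n : ℕ} (h : p + q = n)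
    (Tf : T₁ ⟶ T₂) (Tg : T₂ ⟶ T₃) (Tδ : Ext T₃ T₁ 1)
    (a₁ : Ext S.X₁ T₁ p) (a₂ : Ext S.X₂ T₂ p) (a₃ : Ext S.X₃ T₃ p)
    (c₁ : Ext T₁ S.X₁ q) (c₂ : Ext T₂ S.X₂ q) (c₃ : Ext T₃ S.X₃ q) (εa εc : ℤˣ) (ha_f hc_f ha_g hc_g ha_δ hc_δ) :
    (NaturalAlong.ofComposite hS h Tf Tg Tδ a₁ a₂ a₃ c₁ c₂ c₃ εa εc ha_f hc_f ha_g hc_g ha_δ hc_δ).ω₃ =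
      a₃.comp c₃ h := rfl

end Composite

end Summit.Ventures.HSemireg.TwoLevelObstruction

end
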